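import Mathlib
import HarnessLib
import Summits.QuantumFields.YangMills.Theses.PencilRigidity
import Summits.QuantumFields.YangMills.Theorems.PencilRigidityCurvatureKernelBoundOffDiagonalExtensionFlat

/-!
# `CurvatureKernelBound` — stub A4 support: cut-off estimates for `⁰𝒮` test functions

Support file for crux `stmt-QuantumFields-11687` (`PencilRigidity.CurvatureKernelBound`), line
`sixteen-charts-analytic-kernel`, stub `OffDiagonalExtension` (A4).  Pure analysis:

* Leibniz bookkeeping `‖Dⁿ(ρ • G)‖ ≤ 2ⁿ a c` and derivative bounds for scaled bump functions;
* `cutoff_diag_estimate`: for `F ∈ ⁰𝒮((E)²)` and a bump `b` supported in `‖z‖ ≤ 2`, the diagonal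
  cut-off piece `b(ε⁻¹(x₀ - x₁)) F` is `O(ε)` in every weighted `Cⁿ` norm (flatness of `F` at the
  diagonal beats the `ε⁻ⁿ` from differentiating the cut-off);
* `cutoff_infty_estimate`: for a bump `b = 1` on the unit ball, the piece at infinity `(1 - b(εx)) G`
  has `‖x‖ᵏ ‖Dⁿ(…)‖ ≤ C ε S`, `S` a bound for the weight-`(k+1)` derivatives of `G`;
* `cutoff_error_estimate` / sub-goal `CutoffErrorEstimate`: the total cut-off error
  `(1 - (1 - b(ε⁻¹(x₀ - x₁))) b'(εx)) F` is `O(ε)` in every Schwartz seminorm.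
[folklore]
-/

noncomputable section

open scoped SchwartzMap ContDiff Topology
open Set MeasureTheory Metric Filter
open Literature.MathematicalPhysics.AQFT Literature.MathematicalPhysics.QuantumLattice

namespace Summit.QuantumFields.YangMills.Theorems.CurvatureKernel

/-! ## Leibniz bookkeeping and bump derivatives -/

/-- Leibniz with uniform bounds: `‖Dⁿ(ρ • G)(x)‖ ≤ 2ⁿ a c` if `‖Dⁱρ(x)‖ ≤ a` and `‖DⁱG(x)‖ ≤ c` for
`i ≤ n`. [folklore] -/
theorem norm_iteratedFDeriv_smul_le_of_le {V W : Type*} [NormedAddCommGroup V] [NormedSpace ℝ V]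
    [NormedAddCommGroup W] [NormedSpace ℝ W] {ρ : V → ℝ} {G : V → W} (hρ : ContDiff ℝ ∞ ρ)
    (hG : ContDiff ℝ ∞ G) {n : ℕ} {x : V} {a c : ℝ}
    (ha : ∀ i ≤ n, ‖iteratedFDeriv ℝ i ρ x‖ ≤ a) (hc : ∀ i ≤ n, ‖iteratedFDeriv ℝ i G x‖ ≤ c) :
    ‖iteratedFDeriv ℝ n (fun y => ρ y • G y) x‖ ≤ 2 ^ n * a * c := by
  have ha0 : 0 ≤ a := (norm_nonneg _).trans (ha 0 (Nat.zero_le _))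
  refine (norm_iteratedFDeriv_smul_le (𝕜 := ℝ) hρ hG x (n := n) (mod_cast le_top)).trans ?_
  calc ∑ i ∈ Finset.range (n + 1), (n.choose i : ℝ) * ‖iteratedFDeriv ℝ i ρ x‖ *
        ‖iteratedFDeriv ℝ (n - i) G x‖
      ≤ ∑ i ∈ Finset.range (n + 1), (n.choose i : ℝ) * a * c := by
        refine Finset.sum_le_sum fun i hi => ?_
        have hi' : i ≤ n := Nat.lt_succ_iff.1 (Finset.mem_range.1 hi)
        exact mul_le_mul (mul_le_mul_of_nonneg_left (ha i hi') (by positivity))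
          (hc (n - i) (Nat.sub_le _ _)) (norm_nonneg _) (mul_nonneg (by positivity) ha0)
    _ = 2 ^ n * a * c := by
        rw [← Finset.sum_mul, ← Finset.sum_mul]
        congr 2
        have h := Nat.sum_range_choose n
        exact_mod_cast h

/-- A smooth compactly supported function has bounded derivatives of every order. [folklore] -/
theorem exists_forall_norm_iteratedFDeriv_le {V : Type*} [NormedAddCommGroup V] [NormedSpace ℝ V]
    {f : V → ℝ} (hf : ContDiff ℝ ∞ f) (hc : HasCompactSupport f) (N : ℕ) :
    ∃ B, 0 ≤ B ∧ ∀ i ≤ N, ∀ y, ‖iteratedFDeriv ℝ i f y‖ ≤ B := by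
  have h : ∀ i : ℕ, ∃ B, ∀ y, ‖iteratedFDeriv ℝ i f y‖ ≤ B := fun i =>
    (hf.continuous_iteratedFDeriv (mod_cast le_top)).bounded_above_of_compact_support
      (hc.iteratedFDeriv i)
  choose B hB using h
  refine ⟨∑ i ∈ Finset.range (N + 1), |B i|, Finset.sum_nonneg fun i _ => abs_nonneg _,
    fun i hi y => ?_⟩
  calc ‖iteratedFDeriv ℝ i f y‖ ≤ B i := hB i y
    _ ≤ |B i| := le_abs_self _
    _ ≤ ∑ j ∈ Finset.range (N + 1), |B j| :=
        Finset.single_le_sum (fun j _ => abs_nonneg (B j)) (Finset.mem_range.2 (Nat.lt_succ_of_le hi))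

/-- Derivatives of `f ∘ L` for a continuous linear `L`: `‖Dⁱ(f ∘ L)(x)‖ ≤ (sup ‖Dⁱf‖) ‖L‖ⁱ`.
[folklore] -/
theorem norm_iteratedFDeriv_comp_clm_le {V V' : Type*} [NormedAddCommGroup V] [NormedSpace ℝ V]
    [NormedAddCommGroup V'] [NormedSpace ℝ V'] {f : V' → ℝ} (hf : ContDiff ℝ ∞ f) (L : V →L[ℝ] V')
    {i : ℕ} {B : ℝ} (hB : ∀ y, ‖iteratedFDeriv ℝ i f y‖ ≤ B) (x : V) :
    ‖iteratedFDeriv ℝ i (fun y => f (L y)) x‖ ≤ B * ‖L‖ ^ i := by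
  have h1 : (fun y => f (L y)) = f ∘ L := rfl
  rw [h1, L.iteratedFDeriv_comp_right hf x (mod_cast le_top)]
  refine (ContinuousMultilinearMap.norm_compContinuousLinearMap_le _ _).trans ?_
  simp only [Finset.prod_const, Finset.card_univ, Fintype.card_fin]
  exact mul_le_mul_of_nonneg_right (hB _) (by positivity)

/-- A function vanishing near `x` has vanishing iterated derivatives at `x`. [folklore] -/
theorem iteratedFDeriv_eq_zero_of_eventuallyEq_zero {V W : Type*} [NormedAddCommGroup V]
    [NormedSpace ℝ V] [NormedAddCommGroup W] [NormedSpace ℝ W] {f : V → W} {x : V}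
    (h : f =ᶠ[𝓝 x] 0) (n : ℕ) : iteratedFDeriv ℝ n f x = 0 := by
  have h' := (h.iteratedFDeriv ℝ n).eq_of_nhds
  simpa using h'

/-! ## The diagonal cut-off -/

/-- **Diagonal cut-off estimate, abstract multiplier.** If the derivatives of order `≤ n` of
`F` are flat of order `n + 1` at the diagonal with weight `k` and constant `C`, and `ρ` is a smooth
multiplier with `‖Dⁱρ‖ ≤ a` (`i ≤ n`) vanishing where `‖y₀ - y₁‖ > δ`, then
`(1 + ‖x‖)ᵏ ‖Dⁱ(ρ F)(x)‖ ≤ 2ⁿ a C δⁿ⁺¹`. [folklore] -/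
theorem cutoff_diag_abstract {E : Type*} [NormedAddCommGroup E] [NormedSpace ℝ E]
    (F : 𝓢((Fin 2 → E), ℂ)) {k n : ℕ} {C : ℝ} (hC0 : 0 ≤ C)
    (hC : ∀ l ≤ n, ∀ x : Fin 2 → E,
      (1 + ‖x‖) ^ k * ‖iteratedFDeriv ℝ l (F : (Fin 2 → E) → ℂ) x‖ ≤ C * ‖x 0 - x 1‖ ^ (n + 1))
    {ρ : (Fin 2 → E) → ℝ} (hρ : ContDiff ℝ ∞ ρ) {a δ : ℝ} (hδ : 0 ≤ δ)
    (ha : ∀ i ≤ n, ∀ y, ‖iteratedFDeriv ℝ i ρ y‖ ≤ a)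
    (hρ0 : ∀ y : Fin 2 → E, δ < ‖y 0 - y 1‖ → ρ y = 0) :
    ∀ i ≤ n, ∀ x : Fin 2 → E,
      (1 + ‖x‖) ^ k * ‖iteratedFDeriv ℝ i (fun y => ρ y • F y) x‖ ≤ 2 ^ n * a * C * δ ^ (n + 1) := by
  intro i hi x
  have ha0 : 0 ≤ a := (norm_nonneg _).trans (ha 0 (Nat.zero_le _) x)
  by_cases hx : δ < ‖x 0 - x 1‖
  · have hopen : IsOpen {y : Fin 2 → E | δ < ‖y 0 - y 1‖} :=
      isOpen_lt continuous_const ((continuous_apply 0).sub (continuous_apply 1)).norm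
    have hev : (fun y => ρ y • F y) =ᶠ[𝓝 x] 0 := by
      filter_upwards [hopen.mem_nhds hx] with y hy
      simp [hρ0 y hy]
    rw [iteratedFDeriv_eq_zero_of_eventuallyEq_zero hev, norm_zero, mul_zero]
    positivity
  · push Not at hx
    have hpos : 0 < (1 + ‖x‖) ^ k := by positivity
    have hc : ∀ l ≤ i, ‖iteratedFDeriv ℝ l (F : (Fin 2 → E) → ℂ) x‖ ≤
        C * δ ^ (n + 1) / (1 + ‖x‖) ^ k := by
      intro l hl
      rw [le_div_iff₀ hpos, mul_comm]
      calc (1 + ‖x‖) ^ k * ‖iteratedFDeriv ℝ l (F : (Fin 2 → E) → ℂ) x‖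
          ≤ C * ‖x 0 - x 1‖ ^ (n + 1) := hC l (hl.trans hi) x
        _ ≤ C * δ ^ (n + 1) := by gcongr
    have h := norm_iteratedFDeriv_smul_le_of_le hρ (F.smooth ⊤) (n := i)
      (fun l hl => ha l (hl.trans hi) x) hc
    calc (1 + ‖x‖) ^ k * ‖iteratedFDeriv ℝ i (fun y => ρ y • F y) x‖
        ≤ (1 + ‖x‖) ^ k * (2 ^ i * a * (C * δ ^ (n + 1) / (1 + ‖x‖) ^ k)) := by gcongr
      _ = 2 ^ i * a * C * δ ^ (n + 1) := by field_simp
      _ ≤ 2 ^ n * a * C * δ ^ (n + 1) := by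
          gcongr
          norm_num

/-- **The diagonal cut-off is `O(ε)` in every weighted `Cⁿ` norm.** For a smooth compactly
supported `b : E → ℝ` vanishing on `‖z‖ ≥ 2` and `F ∈ ⁰𝒮((E)²)`:
`(1 + ‖x‖)ᵏ ‖Dⁱ[b(ε⁻¹(x₀ - x₁)) F](x)‖ ≤ C ε` for `i ≤ n`, `0 < ε ≤ 1`. [folklore] -/
theorem cutoff_diag_estimate {E : Type*} [NormedAddCommGroup E] [NormedSpace ℝ E]
    {b : E → ℝ} (hb : ContDiff ℝ ∞ b) (hbc : HasCompactSupport b)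
    (hb2 : ∀ z : E, 2 ≤ ‖z‖ → b z = 0)
    (F : 𝓢((Fin 2 → E), ℂ)) (hF : IsOffDiagonal F) (k n : ℕ) :
    ∃ C, 0 ≤ C ∧ ∀ ε : ℝ, 0 < ε → ε ≤ 1 → ∀ i ≤ n, ∀ x : Fin 2 → E,
      (1 + ‖x‖) ^ k * ‖iteratedFDeriv ℝ i (fun y => b (ε⁻¹ • (y 0 - y 1)) • F y) x‖ ≤ C * ε := by
  obtain ⟨B, hB0, hB⟩ := exists_forall_norm_iteratedFDeriv_le hb hbc n
  obtain ⟨C, hC0, hC⟩ := one_add_pow_mul_norm_iteratedFDeriv_le_of_isOffDiagonal F hF k (n + 1) n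
  refine ⟨2 ^ n * (B * 2 ^ n) * C * 2 ^ (n + 1), by positivity, ?_⟩
  intro ε hε hε1 i hi x
  set L : (Fin 2 → E) →L[ℝ] E :=
    ε⁻¹ • (ContinuousLinearMap.proj (R := ℝ) (φ := fun _ : Fin 2 => E) 0 -
      ContinuousLinearMap.proj (R := ℝ) (φ := fun _ : Fin 2 => E) 1) with hL
  have hLapply : ∀ y, L y = ε⁻¹ • (y 0 - y 1) := fun y => rfl
  have hLnorm : ‖L‖ ≤ 2 * ε⁻¹ := by
    refine ContinuousLinearMap.opNorm_le_bound _ (by positivity) fun y => ?_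
    rw [hLapply, norm_smul, Real.norm_of_nonneg (by positivity)]
    calc ε⁻¹ * ‖y 0 - y 1‖ ≤ ε⁻¹ * (‖y‖ + ‖y‖) := by
          gcongr
          exact (norm_sub_le _ _).trans (add_le_add (norm_le_pi_norm y 0) (norm_le_pi_norm y 1))
      _ = 2 * ε⁻¹ * ‖y‖ := by ring
  have hρ : ContDiff ℝ ∞ (fun y : Fin 2 → E => b (ε⁻¹ • (y 0 - y 1))) := hb.comp L.contDiff
  have h1e : (1 : ℝ) ≤ 2 * ε⁻¹ := by
    have : (1 : ℝ) ≤ ε⁻¹ := one_le_inv_iff₀.2 ⟨hε, hε1⟩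
    linarith
  have ha : ∀ j ≤ n, ∀ y,
      ‖iteratedFDeriv ℝ j (fun y : Fin 2 → E => b (ε⁻¹ • (y 0 - y 1))) y‖ ≤ B * (2 * ε⁻¹) ^ n := by
    intro j hj y
    calc ‖iteratedFDeriv ℝ j (fun y : Fin 2 → E => b (ε⁻¹ • (y 0 - y 1))) y‖
        = ‖iteratedFDeriv ℝ j (fun y => b (L y)) y‖ := rfl
      _ ≤ B * ‖L‖ ^ j := norm_iteratedFDeriv_comp_clm_le hb L (hB j hj) y
      _ ≤ B * (2 * ε⁻¹) ^ j := by gcongr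
      _ ≤ B * (2 * ε⁻¹) ^ n := by gcongr
  have hρ0 : ∀ y : Fin 2 → E, 2 * ε < ‖y 0 - y 1‖ → b (ε⁻¹ • (y 0 - y 1)) = 0 := by
    intro y hy
    apply hb2
    rw [norm_smul, Real.norm_of_nonneg (by positivity), le_inv_mul_iff₀ hε]
    linarith
  have h := cutoff_diag_abstract F (k := k) (n := n) hC0 hC hρ (by positivity : (0 : ℝ) ≤ 2 * ε)
    ha hρ0 i hi x
  calc (1 + ‖x‖) ^ k * ‖iteratedFDeriv ℝ i (fun y => b (ε⁻¹ • (y 0 - y 1)) • F y) x‖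
      ≤ 2 ^ n * (B * (2 * ε⁻¹) ^ n) * C * (2 * ε) ^ (n + 1) := h
    _ = 2 ^ n * (B * 2 ^ n) * C * 2 ^ (n + 1) * ε := by
        rw [mul_pow, mul_pow, pow_succ, inv_pow]
        field_simp
        ring

/-! ## The cut-off at infinity -/

/-- **Cut-off at infinity, abstract multiplier.** If `‖DⁱG(x)‖ (1 + ‖x‖)ᵏ⁺¹ ≤ S` for `i ≤ n`, and
`ρ` is smooth with `‖Dⁱρ‖ ≤ a` (`i ≤ n`) vanishing on the ball `‖y‖ < R`, then
`‖x‖ᵏ ‖Dⁿ(ρ G)(x)‖ ≤ 2ⁿ a S R⁻¹`. [folklore] -/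
theorem cutoff_infty_abstract {V W : Type*} [NormedAddCommGroup V] [NormedSpace ℝ V]
    [NormedAddCommGroup W] [NormedSpace ℝ W] {G : V → W} (hG : ContDiff ℝ ∞ G) {k n : ℕ} {S : ℝ}
    (hS : ∀ i ≤ n, ∀ x, (1 + ‖x‖) ^ (k + 1) * ‖iteratedFDeriv ℝ i G x‖ ≤ S)
    {ρ : V → ℝ} (hρ : ContDiff ℝ ∞ ρ) {a R : ℝ} (hR : 0 < R)
    (ha : ∀ i ≤ n, ∀ y, ‖iteratedFDeriv ℝ i ρ y‖ ≤ a) (hρ0 : ∀ y, ‖y‖ < R → ρ y = 0) :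
    ∀ x, ‖x‖ ^ k * ‖iteratedFDeriv ℝ n (fun y => ρ y • G y) x‖ ≤ 2 ^ n * a * S * R⁻¹ := by
  intro x
  have ha0 : 0 ≤ a := (norm_nonneg _).trans (ha 0 (Nat.zero_le _) x)
  have hS0 : 0 ≤ S := le_trans (by positivity) (hS 0 (Nat.zero_le _) x)
  by_cases hx : ‖x‖ < R
  · have hev : (fun y => ρ y • G y) =ᶠ[𝓝 x] 0 := by
      filter_upwards [(isOpen_lt continuous_norm continuous_const).mem_nhds hx] with y hy
      simp [hρ0 y hy]
    rw [iteratedFDeriv_eq_zero_of_eventuallyEq_zero hev, norm_zero, mul_zero]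
    positivity
  · push Not at hx
    have hpos : 0 < (1 + ‖x‖) ^ (k + 1) := by positivity
    have hc : ∀ i ≤ n, ‖iteratedFDeriv ℝ i G x‖ ≤ S / (1 + ‖x‖) ^ (k + 1) := by
      intro i hi
      rw [le_div_iff₀ hpos, mul_comm]
      exact hS i hi x
    have h := norm_iteratedFDeriv_smul_le_of_le hρ hG (fun i hi => ha i hi x) hc
    have hratio : ‖x‖ ^ k / (1 + ‖x‖) ^ (k + 1) ≤ R⁻¹ := by
      rw [div_le_iff₀ hpos]
      calc ‖x‖ ^ k ≤ (1 + ‖x‖) ^ k := pow_le_pow_left₀ (norm_nonneg _) (by linarith) k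
        _ = R⁻¹ * (R * (1 + ‖x‖) ^ k) := by field_simp
        _ ≤ R⁻¹ * ((1 + ‖x‖) * (1 + ‖x‖) ^ k) := by
            gcongr
            linarith
        _ = R⁻¹ * (1 + ‖x‖) ^ (k + 1) := by ring
    calc ‖x‖ ^ k * ‖iteratedFDeriv ℝ n (fun y => ρ y • G y) x‖
        ≤ ‖x‖ ^ k * (2 ^ n * a * (S / (1 + ‖x‖) ^ (k + 1))) := by gcongr
      _ = 2 ^ n * a * S * (‖x‖ ^ k / (1 + ‖x‖) ^ (k + 1)) := by ring
      _ ≤ 2 ^ n * a * S * R⁻¹ := by gcongr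

/-- **The cut-off at infinity is `O(ε)`.** For a smooth compactly supported `b : V → ℝ` equal to
`1` on the unit ball there is `C` with
`‖x‖ᵏ ‖Dⁿ[(1 - b(εx)) G](x)‖ ≤ C ε S` for every smooth `G` with `(1 + ‖x‖)ᵏ⁺¹ ‖DⁱG(x)‖ ≤ S`
(`i ≤ n`) and `0 < ε ≤ 1`. [folklore] -/
theorem cutoff_infty_estimate {V W : Type*} [NormedAddCommGroup V] [NormedSpace ℝ V]
    [NormedAddCommGroup W] [NormedSpace ℝ W]
    {b : V → ℝ} (hb : ContDiff ℝ ∞ b) (hbc : HasCompactSupport b) (hb1 : ∀ z : V, ‖z‖ ≤ 1 → b z = 1)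
    (k n : ℕ) :
    ∃ C, 0 ≤ C ∧ ∀ G : V → W, ContDiff ℝ ∞ G → ∀ S : ℝ,
      (∀ i ≤ n, ∀ x, (1 + ‖x‖) ^ (k + 1) * ‖iteratedFDeriv ℝ i G x‖ ≤ S) →
      ∀ ε : ℝ, 0 < ε → ε ≤ 1 → ∀ x : V,
        ‖x‖ ^ k * ‖iteratedFDeriv ℝ n (fun y => (1 - b (ε • y)) • G y) x‖ ≤ C * ε * S := by
  obtain ⟨B, hB0, hB⟩ := exists_forall_norm_iteratedFDeriv_le hb hbc n
  refine ⟨2 ^ n * (B + 1), by positivity, ?_⟩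
  intro G hG S hS ε hε hε1 x
  set L : V →L[ℝ] V := ε • ContinuousLinearMap.id ℝ V with hL
  have hLapply : ∀ y, L y = ε • y := fun y => rfl
  have hLnorm : ‖L‖ ≤ ε := by
    refine ContinuousLinearMap.opNorm_le_bound _ hε.le fun y => ?_
    rw [hLapply, norm_smul, Real.norm_of_nonneg hε.le]
  have hbL : ContDiff ℝ ∞ (fun y => b (ε • y)) := hb.comp L.contDiff
  have hρ : ContDiff ℝ ∞ (fun y => 1 - b (ε • y)) := contDiff_const.sub hbL
  have ha : ∀ j ≤ n, ∀ y, ‖iteratedFDeriv ℝ j (fun y => 1 - b (ε • y)) y‖ ≤ B + 1 := by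
    intro j hj y
    rcases Nat.eq_zero_or_pos j with rfl | hjpos
    · rw [norm_iteratedFDeriv_zero]
      have h0 : ‖b (ε • y)‖ ≤ B := by simpa using hB 0 (Nat.zero_le _) (ε • y)
      calc ‖1 - b (ε • y)‖ ≤ ‖(1 : ℝ)‖ + ‖b (ε • y)‖ := norm_sub_le _ _
        _ ≤ 1 + B := by rw [norm_one]; linarith
        _ = B + 1 := add_comm _ _
    · have hfun : (fun y => 1 - b (ε • y)) = (fun _ => (1 : ℝ)) - fun y => b (ε • y) := rfl
      rw [hfun, iteratedFDeriv_sub_apply contDiffAt_const (hbL.of_le (mod_cast le_top)).contDiffAt,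
        iteratedFDeriv_const_of_ne hjpos.ne' (1 : ℝ), Pi.zero_apply, zero_sub, norm_neg]
      calc ‖iteratedFDeriv ℝ j (fun y => b (ε • y)) y‖
          = ‖iteratedFDeriv ℝ j (fun y => b (L y)) y‖ := rfl
        _ ≤ B * ‖L‖ ^ j := norm_iteratedFDeriv_comp_clm_le hb L (hB j hj) y
        _ ≤ B * 1 ^ j := by
            gcongr
            exact hLnorm.trans hε1
        _ ≤ B + 1 := by rw [one_pow, mul_one]; linarith
  have hρ0 : ∀ y, ‖y‖ < ε⁻¹ → 1 - b (ε • y) = 0 := by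
    intro y hy
    rw [hb1 _ ?_, sub_self]
    rw [norm_smul, Real.norm_of_nonneg hε.le]
    calc ε * ‖y‖ ≤ ε * ε⁻¹ := by gcongr
      _ = 1 := mul_inv_cancel₀ hε.ne'
  have h := cutoff_infty_abstract hG hS hρ (inv_pos.2 hε) ha hρ0 x
  calc ‖x‖ ^ k * ‖iteratedFDeriv ℝ n (fun y => (1 - b (ε • y)) • G y) x‖
      ≤ 2 ^ n * (B + 1) * S * ε⁻¹⁻¹ := h
    _ = 2 ^ n * (B + 1) * ε * S := by rw [inv_inv]; ring

/-! ## The total cut-off error -/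

/-- **Cut-off error is `O(ε)` in every Schwartz seminorm.** With a bump `b` on `E` vanishing on
`‖z‖ ≥ 2`, a bump `b'` on `E²` equal to `1` on the unit ball and `F ∈ ⁰𝒮`:
`‖x‖ᵏ ‖Dⁿ[(1 - (1 - b(ε⁻¹(x₀ - x₁))) b'(εx)) F](x)‖ ≤ C ε` for `0 < ε ≤ 1`; split
`1 - (1 - b_ε) b'_ε = b_ε + (1 - b'_ε)(1 - b_ε)` and use the diagonal estimate for the first piece and
the estimate at infinity (against the weight-`(k+1)` bounds of `(1 - b_ε) F`) for the second.
[folklore] -/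
theorem cutoff_error_estimate {E : Type*} [NormedAddCommGroup E] [NormedSpace ℝ E]
    {b : E → ℝ} (hb : ContDiff ℝ ∞ b) (hbc : HasCompactSupport b)
    (hb2 : ∀ z : E, 2 ≤ ‖z‖ → b z = 0)
    {b' : (Fin 2 → E) → ℝ} (hb' : ContDiff ℝ ∞ b') (hbc' : HasCompactSupport b')
    (hb1' : ∀ z : Fin 2 → E, ‖z‖ ≤ 1 → b' z = 1)
    (F : 𝓢((Fin 2 → E), ℂ)) (hF : IsOffDiagonal F) (k n : ℕ) :
    ∃ C, 0 ≤ C ∧ ∀ ε : ℝ, 0 < ε → ε ≤ 1 → ∀ x : Fin 2 → E,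
      ‖x‖ ^ k * ‖iteratedFDeriv ℝ n
        (fun y => (1 - (1 - b (ε⁻¹ • (y 0 - y 1))) * b' (ε • y)) • F y) x‖ ≤ C * ε := by
  obtain ⟨CD, hCD0, hCD⟩ := cutoff_diag_estimate hb hbc hb2 F hF k n
  obtain ⟨CD', hCD0', hCD'⟩ := cutoff_diag_estimate hb hbc hb2 F hF (k + 1) n
  obtain ⟨CI, hCI0, hCI⟩ := cutoff_infty_estimate (W := ℂ) hb' hbc' hb1' k n
  set Sm : ℝ := (Finset.Iic (k + 1, n)).sup (fun p => SchwartzMap.seminorm ℂ p.1 p.2) F with hSm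
  have hSm0 : 0 ≤ Sm := apply_nonneg _ _
  refine ⟨CD + CI * (2 ^ (k + 1) * Sm + CD'), by positivity, ?_⟩
  intro ε hε hε1 x
  set ρ : (Fin 2 → E) → ℝ := fun y => b (ε⁻¹ • (y 0 - y 1)) with hρdef
  set G : (Fin 2 → E) → ℂ := fun y => (1 - ρ y) • F y with hGdef
  have hL : ContDiff ℝ ∞ (fun y : Fin 2 → E => ε⁻¹ • (y 0 - y 1)) :=
    ((contDiff_apply ℝ E 0).sub (contDiff_apply ℝ E 1)).const_smul ε⁻¹
  have hρs : ContDiff ℝ ∞ ρ := hb.comp hL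
  have h1s : ContDiff ℝ ∞ (fun y => ρ y • F y) := hρs.smul (F.smooth ⊤)
  have hGs : ContDiff ℝ ∞ G := (contDiff_const.sub hρs).smul (F.smooth ⊤)
  have hb's : ContDiff ℝ ∞ (fun y : Fin 2 → E => 1 - b' (ε • y)) :=
    contDiff_const.sub (hb'.comp (contDiff_id.const_smul ε))
  have h2s : ContDiff ℝ ∞ (fun y => (1 - b' (ε • y)) • G y) := hb's.smul hGs
  have hsplit : (fun y => (1 - (1 - b (ε⁻¹ • (y 0 - y 1))) * b' (ε • y)) • F y) =
      (fun y => ρ y • F y) + fun y => (1 - b' (ε • y)) • G y := by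
    funext y
    simp only [Pi.add_apply, hGdef, hρdef, smul_smul, ← add_smul]
    congr 1
    ring
  have hSG : ∀ i ≤ n, ∀ y : Fin 2 → E,
      (1 + ‖y‖) ^ (k + 1) * ‖iteratedFDeriv ℝ i G y‖ ≤ 2 ^ (k + 1) * Sm + CD' := by
    intro i hi y
    have hGF : G = (F : (Fin 2 → E) → ℂ) - fun y => ρ y • F y := by
      funext z
      simp only [hGdef, Pi.sub_apply, sub_smul, one_smul]
    rw [hGF, iteratedFDeriv_sub_apply ((F.smooth i).contDiffAt)
      ((h1s.of_le (mod_cast le_top)).contDiffAt)]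
    calc (1 + ‖y‖) ^ (k + 1) * ‖iteratedFDeriv ℝ i (F : (Fin 2 → E) → ℂ) y -
          iteratedFDeriv ℝ i (fun y => ρ y • F y) y‖
        ≤ (1 + ‖y‖) ^ (k + 1) * (‖iteratedFDeriv ℝ i (F : (Fin 2 → E) → ℂ) y‖ +
            ‖iteratedFDeriv ℝ i (fun y => ρ y • F y) y‖) := by
          gcongr
          exact norm_sub_le _ _
      _ = (1 + ‖y‖) ^ (k + 1) * ‖iteratedFDeriv ℝ i (F : (Fin 2 → E) → ℂ) y‖ +
            (1 + ‖y‖) ^ (k + 1) * ‖iteratedFDeriv ℝ i (fun y => ρ y • F y) y‖ := by ring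
      _ ≤ 2 ^ (k + 1) * Sm + CD' * ε :=
          add_le_add (SchwartzMap.one_add_le_sup_seminorm_apply (𝕜 := ℂ) (m := (k + 1, n))
            le_rfl hi F y) (hCD' ε hε hε1 i hi y)
      _ ≤ 2 ^ (k + 1) * Sm + CD' := by nlinarith
  rw [hsplit, iteratedFDeriv_add_apply ((h1s.of_le (mod_cast le_top)).contDiffAt)
    ((h2s.of_le (mod_cast le_top)).contDiffAt)]
  calc ‖x‖ ^ k * ‖iteratedFDeriv ℝ n (fun y => ρ y • F y) x +
        iteratedFDeriv ℝ n (fun y => (1 - b' (ε • y)) • G y) x‖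
      ≤ ‖x‖ ^ k * (‖iteratedFDeriv ℝ n (fun y => ρ y • F y) x‖ +
          ‖iteratedFDeriv ℝ n (fun y => (1 - b' (ε • y)) • G y) x‖) := by
        gcongr
        exact norm_add_le _ _
    _ = ‖x‖ ^ k * ‖iteratedFDeriv ℝ n (fun y => ρ y • F y) x‖ +
          ‖x‖ ^ k * ‖iteratedFDeriv ℝ n (fun y => (1 - b' (ε • y)) • G y) x‖ := by ring
    _ ≤ (1 + ‖x‖) ^ k * ‖iteratedFDeriv ℝ n (fun y => ρ y • F y) x‖ +
          ‖x‖ ^ k * ‖iteratedFDeriv ℝ n (fun y => (1 - b' (ε • y)) • G y) x‖ := by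
        gcongr
        linarith [norm_nonneg x]
    _ ≤ CD * ε + CI * ε * (2 ^ (k + 1) * Sm + CD') :=
        add_le_add (hCD ε hε hε1 n le_rfl x) (hCI G hGs _ hSG ε hε hε1 x)
    _ = (CD + CI * (2 ^ (k + 1) * Sm + CD')) * ε := by ring

/-- **Sub-goal `CutoffErrorEstimate`** (helper for stub `OffDiagonalExtension`): the total cut-off
error is `O(ε)` in every Schwartz seminorm, registered form on `(ℝ⁴)²`. [folklore] -/
theorem CutoffErrorEstimate : open Literature.MathematicalPhysics.AQFT in ∀ (b : EuclideanSpace ℝ (Fin 4) → ℝ), ContDiff ℝ ((⊤ : ℕ∞) : WithTop ℕ∞) b → HasCompactSupport b → (∀ z : EuclideanSpace ℝ (Fin 4), 2 ≤ ‖z‖ → b z = 0) → ∀ (c : (Fin 2 → EuclideanSpace ℝ (Fin 4)) → ℝ), ContDiff ℝ ((⊤ : ℕ∞) : WithTop ℕ∞) c → HasCompactSupport c → (∀ z : Fin 2 → EuclideanSpace ℝ (Fin 4), ‖z‖ ≤ 1 → c z = 1) → ∀ F : SchwartzMap (Fin 2 → EuclideanSpace ℝ (Fin 4)) ℂ, IsOffDiagonal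 F → ∀ k n : ℕ, ∃ C : ℝ, 0 ≤ C ∧ ∀ ε : ℝ, 0 < ε → ε ≤ 1 → ∀ x : Fin 2 → EuclideanSpace ℝ (Fin 4), ‖x‖ ^ k * ‖iteratedFDeriv ℝ n (fun y : Fin 2 → EuclideanSpace ℝ (Fin 4) => (1 - (1 - b (ε⁻¹ • (y 0 - y 1))) * c (ε • y)) • F y) x‖ ≤ C * ε := by
  intro b hb hbc hb2 c hc hcc hc1 F hF k n
  exact cutoff_error_estimate hb hbc hb2 hc hcc hc1 F hF k n

end Summit.QuantumFields.YangMills.Theorems.CurvatureKernel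

end
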